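import Summits.ABC.ABC.Theses.DefiniteXi
import Summits.ABC.ABC.Theorems.EisensteinQuarantine.Negative.EisensteinQuarantineFalseOfProthDepthFamily
import Summits.ABC.ABC.Theorems.EisensteinQuarantine.Negative.EisensteinQuarantineFalseOfForcedPairDepthLaw
import Summits.ABC.ABC.Theorems.EisensteinQuarantine.Negative.EisensteinQuarantineFalseOfEtaTwoDepthLaw
import Summits.ABC.ABC.Theorems.DefiniteXiEisensteinQuarantineThreeAdicCalibration
import Summits.ABC.ABC.Theorems.XiBound.Negative.XiBoundDomainSetup
import Summits.ABC.ABC.Theorems.DefiniteXiEisensteinQuarantineFreyEigenLinePrime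
import Literature.NumberTheory.Automorphic.BrandtXiDvdCongruenceIdeal
import Literature.RingTheory.CompleteIntersection.CotangentFitting
import HarnessLib

/-!
# Strategist sketch S1 — crux stmt-ABC-15023 `DefiniteXi.EisensteinQuarantine` (route `DefiniteXi`)

Companion Lean file of `STRATEGY-CENSUS.md` (crux-strategist re-arm s1, planner-cstrat-stmt-ABC-15023-s1-0,
2026-08-17).  It TYPES the concrete attempts of the four census headings over tree declarations and proves the
glue statements, so that each "no leverage" verdict of the census is about a checked signature, not prose.
Nothing here is a route item, nothing is registered as a line; no `sorry`.

* §1 (Strengthen)  `ForcedPairDepthLawSharp` (adds the `(q+1)`-bit and the quarantined prime's own residuacity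
  term `twoDepth ℓ`) and `ForcedTupleDepthLaw` (additivity over SEVERAL forced partners — the rigid form that
  admits induction on the number of partners); both imply the live line's `ForcedPairDepthLaw` (proved).
* §2 (Decomposition)  the commutative-algebra split of the live line's research stub along the tree's landed
  chain lattice ∣ ring ⊇ Fit(cotangent) (`BrandtXiDvdCongruenceIdeal`):
  `CotangentDepthAtForcedPairs` ∧ `NumericalCriterionAtForcedPairs` (+ the eigen-line = route items r8 ∧ r9)
  ⟹ `ForcedPairDepthLaw` (proved).  The census explains why the second piece is the whole crux (and is the
  piece that FAILS in the open-gate regime at odd `p`: Wake–Wang-Erickson, arXiv:1804.06400, Ex. 1.9.5–1.9.6).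
* §3 (Negation)  the one free bit: on a cuspidal vector of a lattice with odd weights, `⟨φ,φ⟩_w` is even
  (the Eisenstein vector is a characteristic vector of the odd unimodular lattice) — proved; and the witness
  that the same linear method gives nothing modulo `4`.
-/

-- `Summit.<Summit>.<Problem>`: for the single-conjunct summit `ABC` the duplicate `ABC.ABC` is mandated.
set_option linter.dupNamespace false

noncomputable section

namespace Summit.ABC.ABC.Cruxes.EisensteinQuarantine.StrategistS1

open scoped BigOperators
open Literature.NumberTheory.Automorphic Literature.NumberTheory.EllipticCurves
open Literature.RingTheory.CompleteIntersection Literature.RingTheory.FittingIdeal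
open Summit.ABC.ABC.Theorems.EisensteinQuarantine.Negative

/-- The eigenvalue system of the forced-pair Frey curve `E_(−ℓ, ℓ−1)` (triple `1 + (ℓ−1) = ℓ`). -/
abbrev lamF (ℓ : ℕ) : ℕ → ℤ := fun n => (freyCurve (-(ℓ : ℤ)) ((ℓ - 1 : ℕ) : ℤ)).LFunction n

/-! ## §1 Strengthen — more rigid forms of the negation target -/

/-- **S⁺₁ `ForcedPairDepthLawSharp`** — the census-sharp forced-pair law: at a forced pair `(q, ℓ)`
(`32 q ∣ ℓ − 1`) the quarantined congruence number carries the FULL sign-blind Eisenstein charge of the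
partner, `v₂(q² − 1) = v₂(q−1) + v₂(q+1)`, plus the quarantined prime's own residuacity term
`m₂(ℓ) = twoDepth ℓ` (tree: `v₂((ℓ−1)/ord_ℓ 2)`), up to a constant.  Census shape
`v₂ ξ ≈ LL + Σ v₂(q²−1)·[gate] + (m₂(ℓ)+3)` (TRIAGE-r1-1 §Numbers v4; 36/36 rows).  More rigid than
`ForcedPairDepthLaw`; implies it (`forcedPairDepthLaw_of_sharp`). NOT proved, NOT in print. -/
def ForcedPairDepthLawSharp : Prop :=
  ∃ c : ℕ, ∀ q ℓ : ℕ, q.Prime → ℓ.Prime → q ≠ 2 → 32 * q ∣ ℓ - 1 →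
    ∀ N : ℕ, (freyCurve (-(ℓ : ℤ)) ((ℓ - 1 : ℕ) : ℤ)).conductorNorm ℤ = N →
      2 ^ ((q - 1).factorization 2 + (q + 1).factorization 2 + twoDepth ℓ) ≤
        2 ^ c * ordProj[2] (brandtXi (N / ℓ) ℓ (lamF ℓ))

/-- `ForcedPairDepthLawSharp → ForcedPairDepthLaw` (monotonicity of `2^·`). -/
theorem forcedPairDepthLaw_of_sharp (h : ForcedPairDepthLawSharp) : ForcedPairDepthLaw := by
  obtain ⟨c, hc⟩ := h
  refine ⟨c, fun q ℓ hq hℓ hq2 h32 N hN => ?_⟩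
  refine le_trans ?_ (hc q ℓ hq hℓ hq2 h32 N hN)
  exact Nat.pow_le_pow_right (by norm_num) (by omega)

/-- **S⁺₂ `ForcedTupleDepthLaw`** — ADDITIVITY over forced partners (the inductive form): for primes
`q₁, …, q_k` (odd, pairwise distinct) with `32 · ∏ qᵢ ∣ ℓ − 1` (so every `qᵢ` is a forced partner of
the quarantined prime `ℓ`), the depth is at least `Σᵢ v₂(qᵢ − 1) − c·(k+1)`.  This is the shape that would
admit an induction on `k` by one-prime level raising at an Eisenstein prime (adding one unquarantined forced
partner multiplies the 2-part of `ξ` by `(qᵢ − 1)₂` up to `2^c`).  At `k = 1` it is `ForcedPairDepthLaw`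
(`forcedPairDepthLaw_of_tuple`).  Census support: `(17, 5441)` (partners 5 and 17 both forced:
`v₂ ξ ≥ 13 ≥ v₂(16) + v₂(4)`), designed two-partner rows of kit j019312/j019719. NOT proved, NOT in print. -/
def ForcedTupleDepthLaw : Prop :=
  ∃ c : ℕ, ∀ (k : ℕ) (qs : Fin k → ℕ) (ℓ : ℕ), (∀ i, (qs i).Prime) → (∀ i, qs i ≠ 2) →
    Function.Injective qs → ℓ.Prime → 32 * ∏ i, qs i ∣ ℓ - 1 →
    ∀ N : ℕ, (freyCurve (-(ℓ : ℤ)) ((ℓ - 1 : ℕ) : ℤ)).conductorNorm ℤ = N →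
      2 ^ (∑ i, (qs i - 1).factorization 2) ≤
        2 ^ (c * (k + 1)) * ordProj[2] (brandtXi (N / ℓ) ℓ (lamF ℓ))

/-- `ForcedTupleDepthLaw → ForcedPairDepthLaw` (the case of one partner, constant `2c`). -/
theorem forcedPairDepthLaw_of_tuple (h : ForcedTupleDepthLaw) : ForcedPairDepthLaw := by
  obtain ⟨c, hc⟩ := h
  refine ⟨c * 2, fun q ℓ hq hℓ hq2 h32 N hN => ?_⟩
  have h1 := hc 1 ![q] ℓ (fun i => by fin_cases i; simpa using hq) (fun i => by fin_cases i; simpa using hq2)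
    (Function.injective_of_subsingleton _) hℓ (by simpa using h32) N hN
  simpa using h1

/-! ## §2 Decomposition — the commutative-algebra split along the landed chain lattice ∣ ring ⊇ Fit(cotangent) -/

section Decomposition

open scoped Classical

/-- **Piece (D-a) `CotangentDepthAtForcedPairs`** — the COTANGENT space of the anemic Brandt–Hecke ring
`𝕋⁰(S)` at the Frey eigen-augmentation `π_φ` is 2-adically deep at forced pairs: every element of
`Fit₀(ker π_φ/(ker π_φ)²)` is divisible by `2^{v₂(q−1) − c}`.  (Galois-side reading: the reducible
pseudo-deformations of `1 ⊕ 1` through the order-`2^j` character of conductor `q`, which is locally trivial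
at `ℓ` exactly when `ℓ` is a `2^j`-th power mod `q` — automatic at a forced pair — give tangent directions;
but only for a deformation ring `R ↠ 𝕋⁰`, so even this piece needs an `R = 𝕋` statement at `p = 2`.)
NOT proved, NOT in print. -/
def CotangentDepthAtForcedPairs : Prop :=
  ∃ c : ℕ, ∀ q ℓ : ℕ, q.Prime → ℓ.Prime → q ≠ 2 → 32 * q ∣ ℓ - 1 →
    ∀ N : ℕ, (freyCurve (-(ℓ : ℤ)) ((ℓ - 1 : ℕ) : ℤ)).conductorNorm ℤ = N →
    ∀ (S : Brandt.XiSetup (N / ℓ) ℓ) [Fintype (Brandt.ClassSet S.O)],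
      ∀ (φ : Brandt.ClassSet S.O → ℤ) (hφ : φ ≠ 0)
        (hL : Brandt.eigenLattice (N / ℓ * ℓ) (Brandt.matrix S.O) (lamF ℓ) = ℤ ∙ φ),
        ∀ m ∈ Module.fittingIdeal ℤ (CotangentModule (S.eigenAugmentation (lamF ℓ) hφ hL)) 0,
          ((2 ^ ((q - 1).factorization 2 - c) : ℕ) : ℤ) ∣ m

/-- **Piece (D-b) `NumericalCriterionAtForcedPairs`** — the Wiles–Lenstra / de Smit–Rubin–Schoof CONVERSE
at the Frey point: some non-zero element of `Fit₀` of the cotangent module divides `2^{c'} · ξ_S`, i.e. the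
cotangent space is no larger (2-adically, up to `c'`) than the lattice congruence number.  For a complete
intersection `𝕋⁰(S)_𝔪` this is the numerical criterion (dSRS Criterion I); the tree has the other
direction unconditionally (`xi_dvd_twelve_mul_of_mem_fittingIdeal_cotangent`: `ξ ∣ 12·Fit₀`).  THIS is the
piece that remains the whole crux: in the open-gate regime the Eisenstein Hecke algebra is not even
Gorenstein at `p = 5` (Wake–Wang-Erickson, arXiv:1804.06400, Examples 1.9.5–1.9.6, Remark 1.4.8), so no
uniform complete-intersection statement is available to carry cotangent depth down to `ξ`; whether the
defect `length(cotangent) − v₂(ξ)` nevertheless stays bounded along forced pairs is unknown (kit-measurable).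
NOT proved, NOT in print; the only known route to it (c.i. ⟹ dSRS Criterion I) is closed in this regime. -/
def NumericalCriterionAtForcedPairs : Prop :=
  ∃ c' : ℕ, ∀ q ℓ : ℕ, q.Prime → ℓ.Prime → q ≠ 2 → 32 * q ∣ ℓ - 1 →
    ∀ N : ℕ, (freyCurve (-(ℓ : ℤ)) ((ℓ - 1 : ℕ) : ℤ)).conductorNorm ℤ = N →
    ∀ (S : Brandt.XiSetup (N / ℓ) ℓ) [Fintype (Brandt.ClassSet S.O)],
      ∀ (φ : Brandt.ClassSet S.O → ℤ) (hφ : φ ≠ 0)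
        (hL : Brandt.eigenLattice (N / ℓ * ℓ) (Brandt.matrix S.O) (lamF ℓ) = ℤ ∙ φ),
        ∃ m ∈ Module.fittingIdeal ℤ (CotangentModule (S.eigenAugmentation (lamF ℓ) hφ hL)) 0,
          m ≠ 0 ∧ m ∣ ((2 ^ c' * S.xi (lamF ℓ) : ℕ) : ℤ)

/-- **Glue of the split (PROVED)**: eigen-line (route items r8 ∧ r9, in the prime-quarantine form the live
skeleton's `freyEigenLinePrime_of_items` delivers) + (D-a) + (D-b) ⟹ `ForcedPairDepthLaw` with constant
`c + c'`: `2^{j−c} ∣ m ∣ 2^{c'} ξ_S ≠ 0`, so `2^{j−c} ≤ 2^{c'}·ordProj[2] ξ_S`, and `ξ_S = brandtXi` on the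
crux's domain (bookkeeping verbatim from `Lines/forced_pair_dlog.lean`). -/
theorem forcedPairDepthLaw_of_cotangentDepth_of_numericalCriterion
    (hR : ∀ a b : ℤ, IsCoprime a b → a * b * (a + b) ≠ 0 →
      ∀ (N : ℕ) [NeZero N], (freyCurve a b).conductorNorm ℤ = N → Squarefree N →
      ∀ ℓ : ℕ, ℓ.Prime → ℓ ∣ N →
      ∀ (S : Brandt.XiSetup (N / ℓ) ℓ) [Fintype (Brandt.ClassSet S.O)],
        ∃ φ : Brandt.ClassSet S.O → ℤ, φ ≠ 0 ∧
          Brandt.eigenLattice (N / ℓ * ℓ) (Brandt.matrix S.O)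
            (fun n => (freyCurve a b).LFunction n) = ℤ ∙ φ)
    (hA : CotangentDepthAtForcedPairs) (hB : NumericalCriterionAtForcedPairs) :
    ForcedPairDepthLaw := by
  obtain ⟨c, hc⟩ := hA
  obtain ⟨c', hc'⟩ := hB
  refine ⟨c + c', fun q ℓ hq hℓ hq2 h32 N hN => ?_⟩
  -- the Frey data `(a, b) = (−ℓ, ℓ−1)` lie in the crux's domain with `Nm = ℓ` (verbatim from the skeleton)
  have hℓ1 : 1 ≤ ℓ := hℓ.one_lt.le
  have hM0 : ℓ - 1 ≠ 0 := by have := hℓ.two_le; omega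
  have h32' : (32 : ℕ) ∣ ℓ - 1 := (Dvd.intro q rfl).trans h32
  have hℓ2 : ℓ ≠ 2 := by
    intro h
    rw [h] at h32'
    norm_num at h32'
  set a : ℤ := -(ℓ : ℤ) with ha
  set b : ℤ := ((ℓ - 1 : ℕ) : ℤ) with hb
  have hℓcast : (ℓ : ℤ) = ((ℓ - 1 : ℕ) : ℤ) + 1 := by
    rw [Nat.cast_sub hℓ1]; push_cast; ring
  have hab_sum : a + b = -1 := by rw [ha, hb, hℓcast]; ring
  have habc : a * b * (a + b) = ((ℓ * (ℓ - 1) : ℕ) : ℤ) := by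
    rw [hab_sum, ha, hb]; push_cast; ring
  have hPM0 : ℓ * (ℓ - 1) ≠ 0 := Nat.mul_ne_zero hℓ.ne_zero hM0
  have h0 : a * b * (a + b) ≠ 0 := by rw [habc]; exact_mod_cast hPM0
  have hab : IsCoprime a b := by
    rw [ha, hb, IsCoprime.neg_left_iff, Int.isCoprime_iff_gcd_eq_one, Int.gcd_natCast_natCast]
    exact (Nat.coprime_self_sub_right hℓ1).mpr (Nat.coprime_one_right ℓ)
  have ha4 : a ≡ -1 [ZMOD 4] := by
    have h4M : (4 : ℕ) ∣ ℓ - 1 := (show (4 : ℕ) ∣ 32 by norm_num).trans h32'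
    have h4 : (4 : ℤ) ∣ b := by rw [hb]; exact_mod_cast h4M
    have : a = -1 - b := by rw [ha, hb, hℓcast]; ring
    rw [this]
    calc -1 - b ≡ -1 - 0 [ZMOD 4] := Int.ModEq.sub_left _ ((Int.modEq_zero_iff_dvd).mpr h4)
      _ = -1 := by ring
  have hb32 : (32 : ℤ) ∣ b := by rw [hb]; exact_mod_cast h32'
  have hnatAbs : (a * b * (a + b)).natAbs = ℓ * (ℓ - 1) := by rw [habc, Int.natAbs_natCast]
  haveI : (freyCurve a b).IsElliptic := isElliptic_freyCurve h0
  have hNval : N = UniqueFactorizationMonoid.radical (ℓ * (ℓ - 1)) := by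
    rw [← hN, conductorNorm_freyCurve_serre hab h0 ha4 hb32, hnatAbs]
  have hNpos : 0 < N := by rw [hNval]; exact Nat.radical_pos _
  haveI : NeZero N := ⟨hNpos.ne'⟩
  have hNsq : Squarefree N := by rw [hNval]; exact UniqueFactorizationMonoid.squarefree_radical
  have hℓN : ℓ ∣ N := by
    rw [hNval]
    refine Nat.dvd_of_mem_primeFactors ?_
    rw [Nat.primeFactors_radical, Nat.primeFactors_mul hℓ.ne_zero hM0, hℓ.primeFactors]
    simp
  have hodd : Odd ℓ := hℓ.odd_of_ne_two hℓ2
  have hcard : Odd ℓ.primeFactors.card := by rw [hℓ.primeFactors]; simp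
  -- a Brandt setup of type `(N/ℓ, ℓ)` exists and computes `ξ`
  have hne := Summit.ABC.ABC.Theorems.XiBound.Negative.nonempty_xiSetup_freyCurve
    hab h0 hodd hℓ.squarefree hcard (by rw [hN]; exact hℓN)
  rw [hN] at hne
  obtain ⟨S⟩ := hne
  letI : Fintype (Brandt.ClassSet S.O) := Fintype.ofFinite _
  rw [S.brandtXi_eq_xi]
  -- eigen-line (r8 ∧ r9), then (D-b) gives `m ≠ 0`, `m ∣ 2^{c'} ξ`, and (D-a) gives `2^{j−c} ∣ m`
  obtain ⟨φ, hφ, hL⟩ := hR a b hab h0 N hN hNsq ℓ hℓ hℓN S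
  obtain ⟨m, hmF, hm0, hmdvd⟩ := hc' q ℓ hq hℓ hq2 h32 N hN S φ hφ hL
  have h2m : ((2 ^ ((q - 1).factorization 2 - c) : ℕ) : ℤ) ∣ m := hc q ℓ hq hℓ hq2 h32 N hN S φ hφ hL m hmF
  have hchain : 2 ^ ((q - 1).factorization 2 - c) ∣ 2 ^ c' * S.xi (lamF ℓ) :=
    Int.natCast_dvd_natCast.mp (h2m.trans hmdvd)
  -- `ξ_S ≠ 0` on a line (occurrence witness `ψ = 0` modulo `1`)
  have hξ0 : S.xi (lamF ℓ) ≠ 0 :=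
    (Summit.ABC.ABC.Theorems.dvd_xi_of_occurrence S (lamF ℓ) hφ hL 1 (ψ := fun _ => 0)
      (by simp) (by simp)).2
  have hn0 : 2 ^ c' * S.xi (lamF ℓ) ≠ 0 := Nat.mul_ne_zero (pow_ne_zero _ two_ne_zero) hξ0
  have hfac : (2 ^ c' * S.xi (lamF ℓ)).factorization 2 = c' + (S.xi (lamF ℓ)).factorization 2 := by
    rw [Nat.factorization_mul (pow_ne_zero _ two_ne_zero) hξ0, Nat.factorization_pow]
    simp [Nat.prime_two.factorization_self]
  have hle : 2 ^ ((q - 1).factorization 2 - c) ≤ 2 ^ c' * ordProj[2] (S.xi (lamF ℓ)) := by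
    have hv := (Nat.prime_two.pow_dvd_iff_le_factorization hn0).mp hchain
    rw [hfac] at hv
    calc 2 ^ ((q - 1).factorization 2 - c)
        ≤ 2 ^ (c' + (S.xi (lamF ℓ)).factorization 2) := Nat.pow_le_pow_right (by norm_num) hv
      _ = 2 ^ c' * ordProj[2] (S.xi (lamF ℓ)) := by rw [pow_add]
  calc 2 ^ ((q - 1).factorization 2)
      ≤ 2 ^ (c + ((q - 1).factorization 2 - c)) := Nat.pow_le_pow_right (by norm_num) (by omega)
    _ = 2 ^ c * 2 ^ ((q - 1).factorization 2 - c) := pow_add _ _ _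
    _ ≤ 2 ^ c * (2 ^ c' * ordProj[2] (S.xi (lamF ℓ))) := Nat.mul_le_mul_left _ hle
    _ = 2 ^ (c + c') * ordProj[2] (S.xi fun n => (freyCurve a b).LFunction n) := by
        rw [pow_add, mul_assoc]

/-- So (D-a) ∧ (D-b) refute the crux given the route items behind the eigen-line
(`takahashi2001_brandtEigenLattice_rank_one` = r8 verbatim, `FreyModularity` = r9), through the landed
`EisensteinQuarantine_false_of_ForcedPairDepthLaw` (p134266). -/
theorem not_eisensteinQuarantine_of_split
    (hRank : Literature.NumberTheory.EllipticCurves.takahashi2001_brandtEigenLattice_rank_one)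
    (hMod : Summit.ABC.ABC.Theses.DefiniteXi.FreyModularity)
    (hA : CotangentDepthAtForcedPairs) (hB : NumericalCriterionAtForcedPairs) :
    ¬ Summit.ABC.ABC.Theses.DefiniteXi.EisensteinQuarantine :=
  EisensteinQuarantine_false_of_ForcedPairDepthLaw
    (forcedPairDepthLaw_of_cotangentDepth_of_numericalCriterion
      (Summit.ABC.ABC.Theorems.freyEigenLinePrime_of_rankOne_of_freyModularity hRank hMod) hA hB)

end Decomposition

/-! ## §3 Negation — the one free bit, and why the linear method stops there -/

/-- **The Eisenstein vector is characteristic (one free bit).**  For integer weights `w_i` that are all ODD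
and an integer vector `φ` of degree zero (`Σ φ_i = 0` — cuspidality, i.e. `w`-orthogonality to Gross's
Eisenstein vector `e₀ = Σ e_i/w_i`), the weighted norm `⟨φ, φ⟩_w = Σ w_i φ_i²` is EVEN: `w x² ≡ x (mod 2)`.
On the kill family `ℓ ≡ 1 (mod 4)`, so `ℚ(i)` splits at `ℓ` and does not embed in `B_{ℓ,∞}`: no class has a
unit of order 4, every `w_i ∈ {1, 3}` is odd, and `v₂ ξ ≥ 1` for free. [folklore] -/
theorem two_dvd_wnorm_of_sum_eq_zero {ι : Type*} [Fintype ι] (w : ι → ℕ) (φ : ι → ℤ)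
    (hw : ∀ i, Odd (w i)) (hφ : ∑ i, φ i = 0) :
    (2 : ℤ) ∣ ∑ i, (w i : ℤ) * φ i ^ 2 := by
  have key : ∀ i, (2 : ℤ) ∣ (w i : ℤ) * φ i ^ 2 - φ i := by
    intro i
    obtain ⟨k, hk⟩ := hw i
    have hsplit : (w i : ℤ) * φ i ^ 2 - φ i = (w i : ℤ) * (φ i * (φ i - 1)) + ((w i : ℤ) - 1) * φ i := by
      ring
    rw [hsplit]
    refine dvd_add (Dvd.dvd.mul_left (Int.even_mul_pred_self (φ i)).two_dvd _) (Dvd.dvd.mul_right ?_ _)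
    refine ⟨(k : ℤ), ?_⟩
    rw [hk]; push_cast; ring
  have hsum : ∑ i, (w i : ℤ) * φ i ^ 2 = ∑ i, ((w i : ℤ) * φ i ^ 2 - φ i) + ∑ i, φ i := by
    rw [← Finset.sum_add_distrib]
    exact Finset.sum_congr rfl fun i _ => by ring
  rw [hsum, hφ, add_zero]
  exact Finset.dvd_sum fun i _ => key i

/-- **… and exactly one bit**: the same hypotheses do not give `4 ∣ ⟨φ, φ⟩_w` (witness `w = 1`,
`φ = (1, −1)` on two classes: degree `0`, norm `2`).  Modulo `4` the norm counts the odd coordinates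
(`Σ φ_i² ≡ #{i : φ_i odd} (mod 4)`), a genuinely quadratic datum of the reduction `φ mod 2`, i.e. of the
position of the Frey line inside `X/2X[𝔪]` — the structure the crux chain found to be research at `p = 2`. -/
theorem not_four_dvd_wnorm_in_general :
    ¬ ∀ (φ : Fin 2 → ℤ), ∑ i, φ i = 0 → (4 : ℤ) ∣ ∑ i, ((fun _ => (1 : ℕ)) i : ℤ) * φ i ^ 2 := by
  intro h
  have := h ![1, -1] (by simp)
  norm_num [Fin.sum_univ_two] at this

end Summit.ABC.ABC.Cruxes.EisensteinQuarantine.StrategistS1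

end
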